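import Literature.Analysis.Hypoelliptic.EllipticBootstrap
import Literature.Analysis.Hypoelliptic.EllipticParametrixHigherOrder
import Literature.Analysis.Distribution.EllipticReproducingKernel
import Mathlib.Analysis.SpecialFunctions.JapaneseBracket
import Mathlib.Analysis.Calculus.BumpFunction.Normed
import HarnessLib

/-!
# The pointwise a priori estimate `|ψ(y)| ≤ C ‖P ψ‖_{L²}` for an elliptic operator on small balls

Analysis/Hypoelliptic support file (model space: a finite-dimensional real inner product space `V`
with its volume), sequel of `EllipticParametrixHigherOrder.lean`. For a presentation
`P = ∑_{w ∈ S} b_w Y_w` (`smoothDiffOp Y S b`; smooth vector fields and coefficients, words of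
length `≤ k`) which is elliptic of order `k` on the support of a cutoff `χ₁`, `χ₁ = 1` on the
support of a cutoff `χ`, and `2k > dim V`, we prove:

* `exists_pointwise_le_add` — **`|ψ(y)| ≤ K_P ‖P ψ‖₂ + K₀ ‖ψ‖₂`** for every smooth compactly
  supported real `ψ` with `χ = 1` on its support and every point `y`. Proof: with the parametrix
  `twOp q = χ + r` of order `k` (`exists_parametrix_order`), `θ` a normalised bump at `y` and
  `F = 𝓕θ`, one has `ᵗP (Op(q) F) = χ θ + Op(r) F` (`IsAmp.opC_ampOp`), so integrating by parts
  `∫ ψ θ = ∫ (P ψ) Op(q)F - ∫ ψ Op(r)F`; both `Op(q)F` and `Op(r)F` have `L²` norm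
  `≲ ‖F‖_{-k} ≤ ‖⟨ξ⟩^{-k}‖₂ ‖θ‖₁ = ‖⟨ξ⟩^{-k}‖₂` (Plancherel and the Sobolev bound of amplitude
  operators), and `∫ ψ θ → ψ(y)` as the bump shrinks;
* `exists_pointwise_le_smoothDiffOp` — **`|ψ(y)| ≤ C ‖P ψ‖₂` for `ψ` supported in a small ball
  `B(y₀, ε)`** on which `χ = 1` (absorb `‖ψ‖₂ ≤ |B_ε|^{1/2} sup |ψ|`).

This is the analytic input of the local solvability of `ᵗP u = δ` in `L²` (sequel
`Literature/Analysis/Distribution/EllipticPointSolvability.lean`), i.e. of the point-mass case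
of Folland 1995, Thm. (8.45), by duality (Hörmander's solvability criterion).

Auxiliary results proved here: `integral_ofReal_smoothDiffOp_mul` (`∫ (Pψ) g = ∫ ψ ᵗP g` for
complex `g`), `norm_integral_ofReal_mul_le` (Cauchy–Schwarz), `memLp_bwC_neg` (`⟨ξ⟩^{-k} ∈ L²`
for `2k > dim V`), `wnorm_le_of_norm_le` and the Dirac estimate `abs_integral_mul_sub_le`.
Everything is proved; no definitions, no named facts.

## References

* G. B. Folland, *Introduction to Partial Differential Equations*, 2nd ed. (1995), Thm. (6.33),
  Thm. (8.45) (folklore: the elliptic estimate and local solvability).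
* L. Hörmander, *The Analysis of Linear Partial Differential Operators I*, 2nd ed. (1990),
  §7.9, Thm. 13.2.1–13.3.3 (fundamental solutions of elliptic operators; folklore).
* M. E. Taylor, *Pseudodifferential Operators* (1981), Ch. III §1 (folklore).
-/

noncomputable section

open MeasureTheory Set Filter Function TopologicalSpace Real Metric SchwartzMap
open scoped Topology InnerProductSpace BigOperators ContDiff ComplexConjugate FourierTransform ENNReal

namespace Literature.Analysis.Hypoelliptic

open Literature.Analysis.Distribution

variable {V : Type*} [NormedAddCommGroup V] [InnerProductSpace ℝ V] [FiniteDimensional ℝ V]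
  [MeasurableSpace V] [BorelSpace V]

/-! ### Measure-theoretic helpers -/

section Helpers

/-- The `L²` norms of a real function and of its complexification agree. [folklore] -/
theorem eLpNorm_ofReal_eq (f : V → ℝ) (p : ℝ≥0∞) :
    eLpNorm (fun x => (f x : ℂ)) p volume = eLpNorm f p volume :=
  eLpNorm_congr_norm_ae (Eventually.of_forall fun x => by simp)

/-- **`‖ψ‖₂ ≤ |s|^{1/2} · M`** if `ψ` vanishes off the set `s` of finite measure and
`|ψ| ≤ M`. [folklore] -/
theorem toReal_eLpNorm_two_le {ψ : V → ℝ} {s : Set V} (hs : volume s ≠ ⊤)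
    (hψs : Function.support ψ ⊆ s) {M : ℝ} (hM0 : 0 ≤ M) (hM : ∀ x, |ψ x| ≤ M) :
    (eLpNorm ψ 2 volume).toReal ≤ ((volume s) ^ (1 / 2 : ℝ)).toReal * M := by
  rw [← eLpNorm_restrict_eq_of_support_subset hψs]
  have h1 : eLpNorm ψ 2 (volume.restrict s) ≤
      (volume.restrict s) Set.univ ^ (2 : ℝ≥0∞).toReal⁻¹ * ENNReal.ofReal M :=
    eLpNorm_le_of_ae_bound (Eventually.of_forall fun x => by
      rw [Real.norm_eq_abs]; exact hM x)
  rw [Measure.restrict_apply_univ] at h1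
  have h2 : (volume s ^ (2 : ℝ≥0∞).toReal⁻¹ * ENNReal.ofReal M) ≠ ⊤ :=
    ENNReal.mul_ne_top (ENNReal.rpow_ne_top_of_nonneg (by norm_num) hs) ENNReal.ofReal_ne_top
  calc (eLpNorm ψ 2 (volume.restrict s)).toReal
      ≤ (volume s ^ (2 : ℝ≥0∞).toReal⁻¹ * ENNReal.ofReal M).toReal := ENNReal.toReal_mono h2 h1
    _ = ((volume s) ^ (1 / 2 : ℝ)).toReal * M := by
        rw [ENNReal.toReal_mul, ENNReal.toReal_ofReal hM0]
        norm_num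

/-- **Cauchy–Schwarz** for `∫ f g` with `f` real, `g` complex, both continuous and compactly
supported: `‖∫ f g‖ ≤ ‖f‖₂ ‖g‖₂`. [folklore] -/
theorem norm_integral_ofReal_mul_le {f : V → ℝ} {g : V → ℂ} (hf : Continuous f)
    (hfc : HasCompactSupport f) (hg : Continuous g) (hgc : HasCompactSupport g) :
    ‖∫ x, (f x : ℂ) * g x‖ ≤ (eLpNorm f 2 volume).toReal * (eLpNorm g 2 volume).toReal := by
  have hfC : Continuous fun x => (f x : ℂ) := Complex.continuous_ofReal.comp hf
  have hfCc : HasCompactSupport fun x => (f x : ℂ) := hfc.comp_left Complex.ofReal_zero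
  have hF : MemLp (fun x => (f x : ℂ)) 2 volume := hfC.memLp_of_hasCompactSupport hfCc
  have hG : MemLp g 2 volume := hg.memLp_of_hasCompactSupport hgc
  have hinner : ⟪hF.toLp _, hG.toLp _⟫_ℂ = ∫ x, (f x : ℂ) * g x := by
    rw [MeasureTheory.L2.inner_def]
    refine integral_congr_ae ?_
    filter_upwards [hF.coeFn_toLp, hG.coeFn_toLp] with x hx hy
    rw [hx, hy, RCLike.inner_apply, Complex.conj_ofReal, mul_comm]
  calc ‖∫ x, (f x : ℂ) * g x‖ = ‖⟪hF.toLp _, hG.toLp _⟫_ℂ‖ := by rw [hinner]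
    _ ≤ ‖hF.toLp _‖ * ‖hG.toLp _‖ := norm_inner_le_norm _ _
    _ = (eLpNorm f 2 volume).toReal * (eLpNorm g 2 volume).toReal := by
        rw [Lp.norm_toLp, Lp.norm_toLp, eLpNorm_ofReal_eq]

/-- **`⟨ξ⟩^{-k} ∈ L²(V)` when `2k > dim V`.** [folklore] -/
theorem memLp_bwC_neg {k : ℕ} (hk : (Module.finrank ℝ V : ℝ) < 2 * k) :
    MemLp (fun ξ : V => (bw (-(k : ℝ)) ξ : ℂ)) 2 volume := by
  have hmeas : AEStronglyMeasurable (fun ξ : V => (bw (-(k : ℝ)) ξ : ℂ)) volume :=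
    (Complex.continuous_ofReal.comp (continuous_bw _)).aestronglyMeasurable
  rw [memLp_two_iff_integrable_sq_norm hmeas]
  have hint := integrable_rpow_neg_one_add_norm_sq (E := V) (μ := volume) (r := 2 * k) hk
  refine hint.congr (Eventually.of_forall fun ξ => ?_)
  simp only
  rw [Complex.norm_real, Real.norm_of_nonneg (bw_nonneg _ _), bw_def,
    ← Real.rpow_mul_natCast (one_add_norm_sq_pos ξ).le]
  congr 1
  push_cast
  ring

/-- **`‖F‖_{-k} ≤ M ‖⟨ξ⟩^{-k}‖₂`** if `‖F‖ ≤ M` pointwise. [folklore] -/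
theorem wnorm_le_of_norm_le {F : V → ℂ} {M : ℝ} (hM0 : 0 ≤ M) (hM : ∀ ξ, ‖F ξ‖ ≤ M) (s : ℝ) :
    wnorm s F ≤ ENNReal.ofReal M * eLpNorm (fun ξ : V => (bw s ξ : ℂ)) 2 volume := by
  unfold wnorm
  have h1 : eLpNorm (fun ξ : V => (bw s ξ : ℂ) * F ξ) 2 volume ≤
      eLpNorm (fun ξ : V => M • ((bw s ξ : ℂ))) 2 volume := by
    refine eLpNorm_mono fun ξ => ?_
    rw [norm_mul, norm_smul, Real.norm_of_nonneg hM0, mul_comm]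
    exact mul_le_mul_of_nonneg_right (hM ξ) (norm_nonneg _)
  refine h1.trans (le_of_eq ?_)
  change eLpNorm (M • fun ξ : V => (bw s ξ : ℂ)) 2 volume = _
  rw [eLpNorm_const_smul, Real.enorm_eq_ofReal hM0]

/-- **The Dirac estimate**: if `θ ≥ 0`, `∫ θ = 1`, `θ` vanishes off the ball `B(y, δ)` and
`|ψ x - ψ y| ≤ ε` on that ball, then `|∫ θ ψ - ψ y| ≤ ε`. [folklore] -/
theorem abs_integral_mul_sub_le {θ ψ : V → ℝ} (hθ : Continuous θ) (hθc : HasCompactSupport θ)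
    (hψ : Continuous ψ) (hθnn : ∀ x, 0 ≤ θ x) (hθ1 : ∫ x, θ x = 1) {y : V} {δ ε : ℝ}
    (hsupp : Function.support θ ⊆ ball y δ) (hε : ∀ x ∈ ball y δ, |ψ x - ψ y| ≤ ε) :
    |(∫ x, θ x * ψ x) - ψ y| ≤ ε := by
  have hint1 : Integrable θ := hθ.integrable_of_hasCompactSupport hθc
  have hint2 : Integrable (fun x => θ x * ψ x) := (hθ.mul hψ).integrable_of_hasCompactSupport hθc.mul_right
  have e : (∫ x, θ x * ψ x) - ψ y = ∫ x, θ x * (ψ x - ψ y) := by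
    rw [show (fun x => θ x * (ψ x - ψ y)) = fun x => θ x * ψ x - ψ y * θ x by ext x; ring,
      integral_sub hint2 (hint1.const_mul _), integral_const_mul, hθ1, mul_one]
  rw [e]
  have hε0 : 0 ≤ ε := by
    have := hε y (mem_ball_self (by
      by_contra h
      push Not at h
      have : Function.support θ = ∅ := eq_empty_of_subset_empty (hsupp.trans (by
        rw [Metric.ball_eq_empty.2 h]))
      have h0 : (∫ x, θ x) = 0 := by
        rw [show θ = fun _ => 0 from by
          ext x; by_contra hx; exact (this ▸ mem_support.2 hx : x ∈ (∅ : Set V))]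
        simp
      rw [h0] at hθ1; exact zero_ne_one hθ1))
    simpa using this
  calc |∫ x, θ x * (ψ x - ψ y)| ≤ ∫ x, |θ x * (ψ x - ψ y)| := abs_integral_le_integral_abs
    _ ≤ ∫ x, θ x * ε := by
        refine integral_mono_of_nonneg (Eventually.of_forall fun x => abs_nonneg _)
          (hint1.mul_const ε) (Eventually.of_forall fun x => ?_)
        simp only
        rw [abs_mul, abs_of_nonneg (hθnn x)]
        by_cases hx : x ∈ ball y δ
        · exact mul_le_mul_of_nonneg_left (hε x hx) (hθnn x)
        · have : θ x = 0 := by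
            by_contra h; exact hx (hsupp (mem_support.2 h))
          rw [this, zero_mul, zero_mul]
    _ = ε := by rw [integral_mul_const, hθ1, one_mul]

end Helpers

/-! ### Integration by parts against complex functions -/

section IBP

variable {ι : Type*} {Y : ι → V → V} {S : Finset (List ι)} {b : List ι → V → ℝ}

/-- **`∫ (P ψ) g = ∫ ψ (ᵗP g)`** for real smooth `ψ`, complex smooth compactly supported `g`,
`P = smoothDiffOp Y S b` and `ᵗP = opC Y S b` (real and imaginary parts, `opC_re_im`, and the
real integration by parts `integral_smoothDiffOp_mul`). [folklore] -/
theorem integral_ofReal_smoothDiffOp_mul (hY : ∀ i, ContDiff ℝ ∞ (Y i))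
    (hb : ∀ w, ContDiff ℝ ∞ (b w)) {ψ : V → ℝ} (hψ : ContDiff ℝ ∞ ψ) {g : V → ℂ}
    (hg : ContDiff ℝ ∞ g) (hgc : HasCompactSupport g) :
    ∫ x, (smoothDiffOp Y S b ψ x : ℂ) * g x = ∫ x, (ψ x : ℂ) * opC Y S b g x := by
  have hbS : ∀ w ∈ S, ContDiff ℝ ∞ (b w) := fun w _ => hb w
  have hre : ContDiff ℝ ∞ fun x => (g x).re := Complex.reCLM.contDiff.comp hg
  have him : ContDiff ℝ ∞ fun x => (g x).im := Complex.imCLM.contDiff.comp hg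
  have hrec : HasCompactSupport fun x => (g x).re := hgc.comp_left Complex.zero_re
  have himc : HasCompactSupport fun x => (g x).im := hgc.comp_left Complex.zero_im
  have h1 := integral_smoothDiffOp_mul (μ := (volume : Measure V)) hY hbS hψ hre hrec
  have h2 := integral_smoothDiffOp_mul (μ := (volume : Measure V)) hY hbS hψ him himc
  set P := smoothDiffOp Y S b ψ with hP
  have hPs : ContDiff ℝ ∞ P := contDiff_smoothDiffOp hY hbS hψ
  have hT : ∀ {h : V → ℝ}, ContDiff ℝ ∞ h → HasCompactSupport h →
      HasCompactSupport (smoothDiffOpTranspose Y S b h) := fun hh hhc =>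
    hhc.mono' ((subset_tsupport _).trans (tsupport_smoothDiffOpTranspose_subset S b _))
  -- integrability of the four real pieces
  have i1 : Integrable fun x => P x * (g x).re :=
    (hPs.continuous.mul hre.continuous).integrable_of_hasCompactSupport hrec.mul_left
  have i2 : Integrable fun x => P x * (g x).im :=
    (hPs.continuous.mul him.continuous).integrable_of_hasCompactSupport himc.mul_left
  have i3 : Integrable fun x => ψ x * smoothDiffOpTranspose Y S b (fun y => (g y).re) x :=
    (hψ.continuous.mul (contDiff_smoothDiffOpTranspose hY hbS hre).continuous)
      |>.integrable_of_hasCompactSupport (hT hre hrec).mul_left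
  have i4 : Integrable fun x => ψ x * smoothDiffOpTranspose Y S b (fun y => (g y).im) x :=
    (hψ.continuous.mul (contDiff_smoothDiffOpTranspose hY hbS him).continuous)
      |>.integrable_of_hasCompactSupport (hT him himc).mul_left
  have eL : (fun x => (P x : ℂ) * g x) =
      fun x => ((P x * (g x).re : ℝ) : ℂ) + Complex.I * ((P x * (g x).im : ℝ) : ℂ) := by
    ext x
    conv_lhs => rw [← Complex.re_add_im (g x)]
    push_cast; ring
  have eR : (fun x => (ψ x : ℂ) * opC Y S b g x) =
      fun x => ((ψ x * smoothDiffOpTranspose Y S b (fun y => (g y).re) x : ℝ) : ℂ) +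
        Complex.I * ((ψ x * smoothDiffOpTranspose Y S b (fun y => (g y).im) x : ℝ) : ℂ) := by
    ext x
    rw [opC_re_im hY S hb hg]
    push_cast; ring
  rw [eL, eR, integral_add i1.ofReal (i2.ofReal.const_mul _),
    integral_add i3.ofReal (i4.ofReal.const_mul _), integral_const_mul, integral_const_mul,
    integral_complex_ofReal, integral_complex_ofReal, integral_complex_ofReal,
    integral_complex_ofReal, h1, h2]

end IBP

/-! ### The pointwise estimates -/

section Estimate

variable {ι : Type*} {Y : ι → V → V} {S : Finset (List ι)} {b : List ι → V → ℝ} {k : ℕ}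

/-- The `L²` norm of a smooth compactly supported function through its Fourier transform:
`‖w‖₂ = rn 0 (𝓕 w)` (Plancherel on the Schwartz avatar). [folklore] -/
theorem toReal_eLpNorm_eq_rn_fourier {w : V → ℂ} (hw : ContDiff ℝ ∞ w) (hwc : HasCompactSupport w) :
    (eLpNorm w 2 volume).toReal = rn 0 (𝓕 w) := by
  obtain ⟨ws, hws⟩ := exists_avatarV hw hwc
  have hwfun : w = (ws : V → ℂ) := funext hws
  rw [hwfun, ← SchwartzMap.norm_toLp (f := ws) (p := 2) (μ := volume), ← norm_fourier_toL2_eq,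
    norm_toLp_eq_rn, SchwartzMap.fourier_coe]

/-- **`|ψ(y)| ≤ K_P ‖P ψ‖₂ + K₀ ‖ψ‖₂`.** Let `P = ∑_{w ∈ S} b_w Y_w` (`smoothDiffOp Y S b`) have
words of length `≤ k` with `2k > dim V`, let `χ`, `χ₁` be smooth compactly supported cutoffs with
`χ₁ = 1` on `tsupport χ`, and let the presentation be elliptic of order `k` on `tsupport χ₁`. Then
there are constants `K_P, K₀ ≥ 0` such that every smooth compactly supported real `ψ` with
`χ = 1` on its support satisfies `|ψ y| ≤ K_P ‖P ψ‖_{L²} + K₀ ‖ψ‖_{L²}` at every point `y`. See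
the module docstring for the proof. Folland 1995, Thm. (6.33)/(8.45) (folklore form).
[folklore] -/
theorem exists_pointwise_le_add [Nontrivial V] (hY : ∀ i, ContDiff ℝ ∞ (Y i))
    (hb : ∀ w, ContDiff ℝ ∞ (b w)) (hS : ∀ w ∈ S, w.length ≤ k)
    (hk : (Module.finrank ℝ V : ℝ) < 2 * k)
    {χ χ₁ : V → ℝ} (hχ : ContDiff ℝ ∞ χ) (hχc : HasCompactSupport χ)
    (hχ₁ : ContDiff ℝ ∞ χ₁) (hχ₁c : HasCompactSupport χ₁) (hχχ₁ : ∀ x ∈ tsupport χ, χ₁ x = 1)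
    (hell : ∀ x ∈ tsupport χ₁, ∀ ξ : V, ξ ≠ 0 → twSymb Y S b k x ξ ≠ 0) :
    ∃ Kp K0 : ℝ, 0 ≤ Kp ∧ 0 ≤ K0 ∧ ∀ ψ : V → ℝ, ContDiff ℝ ∞ ψ → HasCompactSupport ψ →
      (∀ x, ψ x ≠ 0 → χ x = 1) → ∀ y : V,
        |ψ y| ≤ Kp * (eLpNorm (smoothDiffOp Y S b ψ) 2 volume).toReal +
          K0 * (eLpNorm ψ 2 volume).toReal := by
  -- the parametrix of order `k` and the Sobolev constants
  obtain ⟨q, r, hq, hr, -, -, hqr⟩ :=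
    exists_parametrix_order hY hb hS hχ hχc hχ₁ hχ₁c hχχ₁ hell k
  have hr' : IsAmp r (-(k : ℝ)) := hr.mono (by linarith)
  obtain ⟨Cq, hCq0, hCq⟩ := hq.exists_wnorm_fourier_ampOp_le (-(k : ℝ))
  obtain ⟨Cr, hCr0, hCr⟩ := hr'.exists_wnorm_fourier_ampOp_le (-(k : ℝ))
  -- the weight constant `Ik = ‖⟨ξ⟩^{-k}‖₂`
  have hbwC := memLp_bwC_neg (V := V) hk
  set Ik : ℝ := (eLpNorm (fun ξ : V => (bw (-(k : ℝ)) ξ : ℂ)) 2 volume).toReal with hIk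
  have hIk0 : 0 ≤ Ik := ENNReal.toReal_nonneg
  refine ⟨Cq * Ik, Cr * Ik, by positivity, by positivity, fun ψ hψ hψc hψχ y => ?_⟩
  set Pψ := smoothDiffOp Y S b ψ with hPψ
  have hPψs : ContDiff ℝ ∞ Pψ := contDiff_smoothDiffOp hY (fun w _ => hb w) hψ
  have hPψc : HasCompactSupport Pψ :=
    hψc.mono' ((subset_tsupport _).trans (tsupport_smoothDiffOp_subset S b ψ))
  -- for every `ε > 0`, `|ψ y| ≤ Kp ‖Pψ‖₂ + K0 ‖ψ‖₂ + ε`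
  refine le_of_forall_pos_le_add fun ε hε => ?_
  obtain ⟨δ, hδ, hδε⟩ := Metric.continuousAt_iff.1 hψ.continuous.continuousAt ε hε
  -- the bump `θ` at `y` and its Schwartz avatar
  let θb : ContDiffBump y := ⟨δ / 2, δ, by positivity, by linarith⟩
  set θ : V → ℝ := θb.normed volume with hθ
  have hθs : ContDiff ℝ ∞ θ := θb.contDiff_normed
  have hθc : HasCompactSupport θ := θb.hasCompactSupport_normed
  have hθ1 : ∫ x, θ x = 1 := θb.integral_normed
  have hθnn : ∀ x, 0 ≤ θ x := fun x => θb.nonneg_normed x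
  have hθsupp : Function.support θ ⊆ ball y δ := by rw [hθ, θb.support_normed_eq]
  obtain ⟨θS, hθS, -⟩ := exists_avatarV_real hθs hθc
  have hθSfun : (θS : V → ℂ) = fun x => (θ x : ℂ) := funext fun x => (hθS x).symm
  -- Fourier data `F = 𝓕 θ`
  set F : V → ℂ := 𝓕 (θS : V → ℂ) with hFdef
  have hFn : Nice F := by
    have h := SchwartzMap.nice (𝓕 θS)
    rwa [SchwartzMap.fourier_coe] at h
  have hinvF : 𝓕⁻ F = (θS : V → ℂ) := by
    rw [hFdef, ← SchwartzMap.fourier_coe, ← SchwartzMap.fourierInv_coe,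
      FourierTransform.fourierInv_fourier_eq]
  -- the bound `‖F‖ ≤ 1` and `‖F‖_{-k} ≤ Ik`
  have hL1 : ‖θS.toLp 1 (volume : Measure V)‖ = 1 := by
    rw [SchwartzMap.norm_toLp_one, hθSfun]
    simp only [Complex.norm_real, Real.norm_eq_abs]
    rw [show (fun x => |θ x|) = θ from funext fun x => abs_of_nonneg (hθnn x), hθ1]
  have hFle : ∀ ξ, ‖F ξ‖ ≤ 1 := fun ξ => by
    rw [hFdef, ← SchwartzMap.fourier_coe]
    exact (SchwartzMap.norm_fourier_apply_le_toLp_one θS ξ).trans hL1.le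
  have hFk : rn (-(k : ℝ)) F ≤ Ik := by
    have h := wnorm_le_of_norm_le zero_le_one hFle (-(k : ℝ))
    rw [ENNReal.ofReal_one, one_mul] at h
    exact ENNReal.toReal_mono hbwC.eLpNorm_ne_top h
  -- `w = Op(q) F`, `ρ = Op(r) F`
  set w : V → ℂ := ampOp q F with hwdef
  set ρ : V → ℂ := ampOp r F with hρdef
  have hws : ContDiff ℝ ∞ w := hq.contDiff_ampOp hFn
  have hρs : ContDiff ℝ ∞ ρ := hr'.contDiff_ampOp hFn
  have hwc : HasCompactSupport w := hq.hasCompactSupport_ampOp F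
  have hρc : HasCompactSupport ρ := hr'.hasCompactSupport_ampOp F
  -- `‖w‖₂ ≤ Cq Ik`, `‖ρ‖₂ ≤ Cr Ik`
  have hw2 : (eLpNorm w 2 volume).toReal ≤ Cq * Ik := by
    rw [toReal_eLpNorm_eq_rn_fourier hws hwc]
    have h := hCq F hFn
    rw [show (-(k : ℝ)) - (-(k : ℝ)) = 0 by ring] at h
    exact (rn_le_of_wnorm_le hCq0 h (hFn.2 _)).trans (mul_le_mul_of_nonneg_left hFk hCq0)
  have hρ2 : (eLpNorm ρ 2 volume).toReal ≤ Cr * Ik := by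
    rw [toReal_eLpNorm_eq_rn_fourier hρs hρc]
    have h := hCr F hFn
    rw [show (-(k : ℝ)) - (-(k : ℝ)) = 0 by ring] at h
    exact (rn_le_of_wnorm_le hCr0 h (hFn.2 _)).trans (mul_le_mul_of_nonneg_left hFk hCr0)
  -- the parametrix identity `ᵗP w = χ θ + ρ`
  have hdec : ∀ x, opC Y S b w x = (χ x : ℂ) * (θ x : ℂ) + ρ x := by
    intro x
    have h1 := hq.opC_ampOp hY S hb hFn
    rw [hqr, (IsAmp.of_fun_real hχ hχc).ampOp_add hr hFn, ampOp_of_fun, hinvF, hθSfun] at h1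
    exact congrFun h1 x
  -- integrate by parts: `∫ (Pψ) w = ∫ ψ θ + ∫ ψ ρ`
  have hIBP := integral_ofReal_smoothDiffOp_mul (S := S) hY hb hψ hws hwc
  have hψχ' : ∀ x, (ψ x : ℂ) * ((χ x : ℂ) * (θ x : ℂ)) = ((ψ x * θ x : ℝ) : ℂ) := by
    intro x
    by_cases hx : ψ x = 0
    · simp [hx]
    · rw [hψχ x hx]; push_cast; ring
  have iA : Integrable fun x => ((ψ x * θ x : ℝ) : ℂ) :=
    ((hψ.continuous.mul hθs.continuous).integrable_of_hasCompactSupport hθc.mul_left).ofReal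
  have iB : Integrable fun x => (ψ x : ℂ) * ρ x :=
    ((Complex.continuous_ofReal.comp hψ.continuous).mul hρs.continuous).integrable_of_hasCompactSupport
      hρc.mul_left
  have hsplit : ∫ x, (Pψ x : ℂ) * w x = ((∫ x, ψ x * θ x : ℝ) : ℂ) + ∫ x, (ψ x : ℂ) * ρ x := by
    rw [hIBP]
    have e : (fun x => (ψ x : ℂ) * opC Y S b w x) =
        fun x => ((ψ x * θ x : ℝ) : ℂ) + (ψ x : ℂ) * ρ x := by
      ext x; rw [hdec x, mul_add, hψχ' x]
    rw [e, integral_add iA iB, integral_complex_ofReal]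
  -- the Dirac estimate
  have hDirac : |(∫ x, θ x * ψ x) - ψ y| ≤ ε := by
    refine abs_integral_mul_sub_le hθs.continuous hθc hψ.continuous hθnn hθ1 hθsupp
      fun x hx => ?_
    have := hδε hx
    rw [Real.dist_eq] at this
    exact this.le
  -- assemble
  have hmain : ‖((∫ x, ψ x * θ x : ℝ) : ℂ)‖ ≤
      Cq * Ik * (eLpNorm Pψ 2 volume).toReal + Cr * Ik * (eLpNorm ψ 2 volume).toReal := by
    have e : ((∫ x, ψ x * θ x : ℝ) : ℂ) = (∫ x, (Pψ x : ℂ) * w x) - ∫ x, (ψ x : ℂ) * ρ x := by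
      rw [hsplit]; ring
    rw [e]
    have hA := norm_integral_ofReal_mul_le hPψs.continuous hPψc hws.continuous hwc
    have hB := norm_integral_ofReal_mul_le hψ.continuous hψc hρs.continuous hρc
    have hn1 : 0 ≤ (eLpNorm Pψ 2 volume).toReal := ENNReal.toReal_nonneg
    have hn2 : 0 ≤ (eLpNorm ψ 2 volume).toReal := ENNReal.toReal_nonneg
    calc ‖(∫ x, (Pψ x : ℂ) * w x) - ∫ x, (ψ x : ℂ) * ρ x‖
        ≤ ‖∫ x, (Pψ x : ℂ) * w x‖ + ‖∫ x, (ψ x : ℂ) * ρ x‖ := norm_sub_le _ _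
      _ ≤ (eLpNorm Pψ 2 volume).toReal * (Cq * Ik) + (eLpNorm ψ 2 volume).toReal * (Cr * Ik) :=
          add_le_add (hA.trans (mul_le_mul_of_nonneg_left hw2 hn1))
            (hB.trans (mul_le_mul_of_nonneg_left hρ2 hn2))
      _ = _ := by ring
  have hreal : |∫ x, ψ x * θ x| = ‖((∫ x, ψ x * θ x : ℝ) : ℂ)‖ := by
    rw [Complex.norm_real, Real.norm_eq_abs]
  have hcomm : (∫ x, θ x * ψ x) = ∫ x, ψ x * θ x :=
    integral_congr_ae (Eventually.of_forall fun x => mul_comm _ _)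
  calc |ψ y| = |(ψ y - ∫ x, θ x * ψ x) + ∫ x, ψ x * θ x| := by rw [hcomm]; ring_nf
    _ ≤ |ψ y - ∫ x, θ x * ψ x| + |∫ x, ψ x * θ x| := abs_add_le _ _
    _ ≤ ε + (Cq * Ik * (eLpNorm Pψ 2 volume).toReal + Cr * Ik * (eLpNorm ψ 2 volume).toReal) := by
        refine add_le_add ?_ (hreal ▸ hmain)
        rw [abs_sub_comm]; exact hDirac
    _ = _ := by ring

/-- **`|ψ(y)| ≤ C ‖P ψ‖_{L²}` on small balls.** In the situation of `exists_pointwise_le_add`,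
suppose `χ = 1` on the ball `B(y₀, R)`. Then there are `ε ∈ (0, R]` and `C ≥ 0` such that every
smooth real `ψ` with `tsupport ψ ⊆ B(y₀, ε)` satisfies `|ψ y| ≤ C ‖P ψ‖_{L²}` for all `y`
(from `exists_pointwise_le_add` and `‖ψ‖₂ ≤ |B_ε|^{1/2} sup |ψ|`, absorbing for `ε` small).
This is Hörmander's a priori inequality behind the local solvability of `ᵗP u = δ_{y}` in `L²`.
Folland 1995, Thm. (8.45) (folklore form). [folklore] -/
theorem exists_pointwise_le_smoothDiffOp [Nontrivial V] (hY : ∀ i, ContDiff ℝ ∞ (Y i))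
    (hb : ∀ w, ContDiff ℝ ∞ (b w)) (hS : ∀ w ∈ S, w.length ≤ k)
    (hk : (Module.finrank ℝ V : ℝ) < 2 * k)
    {χ χ₁ : V → ℝ} (hχ : ContDiff ℝ ∞ χ) (hχc : HasCompactSupport χ)
    (hχ₁ : ContDiff ℝ ∞ χ₁) (hχ₁c : HasCompactSupport χ₁) (hχχ₁ : ∀ x ∈ tsupport χ, χ₁ x = 1)
    (hell : ∀ x ∈ tsupport χ₁, ∀ ξ : V, ξ ≠ 0 → twSymb Y S b k x ξ ≠ 0)
    {y₀ : V} {R : ℝ} (hR : 0 < R) (hχR : ∀ x ∈ ball y₀ R, χ x = 1) :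
    ∃ ε : ℝ, 0 < ε ∧ ε ≤ R ∧ ∃ C : ℝ, 0 ≤ C ∧ ∀ ψ : V → ℝ, ContDiff ℝ ∞ ψ →
      tsupport ψ ⊆ ball y₀ ε → ∀ y : V,
        |ψ y| ≤ C * (eLpNorm (smoothDiffOp Y S b ψ) 2 volume).toReal := by
  obtain ⟨Kp, K0, hKp, hK0, hest⟩ := exists_pointwise_le_add hY hb hS hk hχ hχc hχ₁ hχ₁c hχχ₁ hell
  -- the volume of balls
  set c₁ : ℝ := (volume (ball (0 : V) 1)).toReal with hc₁
  have hc₁0 : 0 ≤ c₁ := ENNReal.toReal_nonneg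
  set ε : ℝ := min R (min 1 (1 / (4 * K0 ^ 2 * c₁ + 1))) with hεdef
  have hε0 : 0 < ε := by
    rw [hεdef]
    refine lt_min hR (lt_min one_pos ?_)
    positivity
  have hεR : ε ≤ R := min_le_left _ _
  have hε1 : ε ≤ 1 := (min_le_right _ _).trans (min_le_left _ _)
  have hε2 : ε ≤ 1 / (4 * K0 ^ 2 * c₁ + 1) := (min_le_right _ _).trans (min_le_right _ _)
  -- `volume (ball y₀ ε) ≤ ε c₁` and the smallness `4 K0² vol ≤ 1`
  have hvol : volume (ball y₀ ε) = ENNReal.ofReal (ε ^ Module.finrank ℝ V) * volume (ball (0 : V) 1) :=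
    Measure.addHaar_ball volume y₀ hε0.le
  have hvol_top : volume (ball y₀ ε) ≠ ⊤ := measure_ball_lt_top.ne
  have hvolR : (volume (ball y₀ ε)).toReal ≤ ε * c₁ := by
    rw [hvol, ENNReal.toReal_mul, ENNReal.toReal_ofReal (by positivity), ← hc₁]
    refine mul_le_mul_of_nonneg_right ?_ hc₁0
    have hd : 1 ≤ Module.finrank ℝ V := Module.finrank_pos
    calc ε ^ Module.finrank ℝ V ≤ ε ^ 1 := pow_le_pow_of_le_one hε0.le hε1 hd
      _ = ε := pow_one ε
  have hsmall : 4 * K0 ^ 2 * (volume (ball y₀ ε)).toReal ≤ 1 := by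
    have h1 : 4 * K0 ^ 2 * (volume (ball y₀ ε)).toReal ≤ 4 * K0 ^ 2 * (ε * c₁) :=
      mul_le_mul_of_nonneg_left hvolR (by positivity)
    refine h1.trans ?_
    have h2 : ε * (4 * K0 ^ 2 * c₁ + 1) ≤ 1 := by
      rw [le_div_iff₀ (by positivity)] at hε2; exact hε2
    nlinarith [mul_nonneg (mul_nonneg (by norm_num : (0 : ℝ) ≤ 4) (sq_nonneg K0)) hc₁0]
  refine ⟨ε, hε0, hεR, 2 * Kp, by positivity, fun ψ hψ hψε y => ?_⟩
  -- basic properties of `ψ`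
  have hψc : HasCompactSupport ψ :=
    IsCompact.of_isClosed_subset (isCompact_closedBall y₀ ε) (isClosed_tsupport ψ)
      (hψε.trans ball_subset_closedBall)
  have hsuppψ : Function.support ψ ⊆ ball y₀ ε := (subset_tsupport ψ).trans hψε
  have hψχ : ∀ x, ψ x ≠ 0 → χ x = 1 := fun x hx =>
    hχR x (ball_subset_ball hεR (hsuppψ (mem_support.2 hx)))
  set A : ℝ := (eLpNorm (smoothDiffOp Y S b ψ) 2 volume).toReal with hA
  set B : ℝ := (eLpNorm ψ 2 volume).toReal with hB
  have hA0 : 0 ≤ A := ENNReal.toReal_nonneg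
  have hB0 : 0 ≤ B := ENNReal.toReal_nonneg
  -- the sup of `|ψ|`
  obtain ⟨xM, hxM⟩ := (continuous_abs.comp hψ.continuous).exists_forall_ge_of_hasCompactSupport
    hψc.abs
  set M : ℝ := |ψ xM| with hM
  have hM0 : 0 ≤ M := abs_nonneg _
  have hMest : M ≤ Kp * A + K0 * B := hest ψ hψ hψc hψχ xM
  -- `B ≤ vol^{1/2} M`
  set sv : ℝ := ((volume (ball y₀ ε)) ^ (1 / 2 : ℝ)).toReal with hsv
  have hsv0 : 0 ≤ sv := ENNReal.toReal_nonneg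
  have hBle : B ≤ sv * M := toReal_eLpNorm_two_le hvol_top hsuppψ hM0 (fun x => hxM x)
  -- `sv² = vol`, so `2 K0 sv ≤ 1`
  have hsv_sq : sv ^ 2 = (volume (ball y₀ ε)).toReal := by
    rw [hsv, ← ENNReal.toReal_rpow, ← Real.rpow_natCast, ← Real.rpow_mul ENNReal.toReal_nonneg]
    norm_num
  have h2K0 : 2 * K0 * sv ≤ 1 := by
    have h1 : (2 * K0 * sv) ^ 2 ≤ 1 := by
      calc (2 * K0 * sv) ^ 2 = 4 * K0 ^ 2 * sv ^ 2 := by ring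
        _ ≤ 1 := by rw [hsv_sq]; exact hsmall
    have h2 : 0 ≤ 2 * K0 * sv := by positivity
    nlinarith
  -- absorb: `B ≤ sv (Kp A + K0 B)` gives `B ≤ 2 sv Kp A`
  have hB2 : B ≤ 2 * sv * Kp * A := by
    have h1 : B ≤ sv * (Kp * A + K0 * B) := hBle.trans (mul_le_mul_of_nonneg_left hMest hsv0)
    nlinarith [mul_nonneg hsv0 hKp, mul_nonneg hK0 hB0]
  have hy := hest ψ hψ hψc hψχ y
  calc |ψ y| ≤ Kp * A + K0 * B := hy
    _ ≤ Kp * A + K0 * (2 * sv * Kp * A) := by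
        exact add_le_add le_rfl (mul_le_mul_of_nonneg_left hB2 hK0)
    _ = Kp * A + (2 * K0 * sv) * (Kp * A) := by ring
    _ ≤ Kp * A + 1 * (Kp * A) := by
        exact add_le_add le_rfl (mul_le_mul_of_nonneg_right h2K0 (mul_nonneg hKp hA0))
    _ = 2 * Kp * A := by ring

end Estimate

end Literature.Analysis.Hypoelliptic
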